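import Summits.RiemannHypothesis.RiemannHypothesis.Theorems.GroundBartaPolarPerronFrobeniusGapCert8046
import Summits.RiemannHypothesis.RiemannHypothesis.Theorems.GroundBartaPolarPerronFrobeniusGapTransferWindowsTw2
import HarnessLib

/-!
# Unconditional almost-positivity of every ground state at `a = 4023/5000`
(route `RiemannHypothesis/GroundBarta`, crux `PolarPerronFrobenius` = stmt-RiemannHypothesis-18390, helper; RH-free, no
definitions, no named facts, no sorry)

`groundState_8046_almost_nonneg_of_gapCertificate` (…GapTransferWindows: cone bottom `ε₊ ≤ 10⁻¹⁷`, positivity, parity) with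
its one hypothesis discharged by the landed gap certificate `gc_gapCertificate_8046` (…GapCert8046, `m₂ = 3·10⁻¹²`):
* `groundState_8046_almost_nonneg` — for every `δ' > 10⁻¹⁷` with `2δ' < 3·10⁻¹²` and EVERY ground state `u` of the full
  windowed Weil form at `4023/5000`, some unit `c` has `∫ ((Re(c u))⁻)² + (Im(c u))² ≤ 4δ'/(3·10⁻¹² − 2δ')`;
* `groundState_8046_negPart_le` — `≤ 1/68000` (`δ' = 1.1·10⁻¹⁷`): the negative and imaginary parts of every phase-fixed
  normalised ground state at `0.8046` have `L²`-norm `≤ 3.9·10⁻³`.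
BAND VERSIONS (a continuum of windows, same certificate restricted to smaller windows + the landed cone bottoms of
`…RitzSignNearBottom` at `39/50`, `77/100`, `3/4`, antitone in the window, + positivity and parity on `(0, (log 5)/2]`):
* `groundState_almost_nonneg_of_le_8046` — generic: window `a ≤ 4023/5000` with cone bottom `ε₊(a) ≤ δ₀ < δ'`;
* ★ `groundState_band78_negPart_le` — for EVERY `a ∈ [39/50, 4023/5000]` and every ground state `u` at `a`:
  `∫ ((Re(c u))⁻)² + (Im(c u))² ≤ 1/4400` for a unit `c`;
* `groundState_band77_negPart_le` (`a ∈ [77/100, 4023/5000]`, `≤ 1/22`), `groundState_band75_negPart_le` (`a ∈ [3/4, 4023/5000]`,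
  `≤ 1/9`).  Prover B, speedrun unit `sr-gb-rung-b` (gen 17).
-/

set_option linter.dupNamespace false

noncomputable section

open MeasureTheory Set Filter
open scoped Topology ComplexConjugate

namespace Summit.RiemannHypothesis.RiemannHypothesis.Theorems.PolarPerronFrobenius

open Literature.NumberTheory.LFunctions
open Summit.RiemannHypothesis.RiemannHypothesis.Theorems.EvenWinsBeyondArch

/-- **UNCONDITIONAL ALMOST-POSITIVITY OF EVERY GROUND STATE AT `a = 4023/5000`.**  For every `δ' > 10⁻¹⁷` with
`2δ' < 3·10⁻¹²` and every ground state `u` of the full windowed Weil form at `a = 4023/5000` (`IsWeilGroundState`), some unit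
scalar `c` has `∫ ((Re(c u))⁻)² + (Im(c u))² ≤ 4δ'/(3·10⁻¹² − 2δ')`.  RH-free; all inputs are landed kernel facts
(`groundState_8046_almost_nonneg_of_gapCertificate` + `gc_gapCertificate_8046`). [folklore] -/
theorem groundState_8046_almost_nonneg {δ' : ℝ} (hδ' : (1 / 100000000000000000 : ℝ) < δ')
    (hm : 2 * δ' < (3 / 1000000000000 : ℝ)) {u : ℝ → ℂ} (hu : IsWeilGroundState (4023 / 5000 : ℝ) u) :
    ∃ c : ℂ, ‖c‖ = 1 ∧
      ∫ t, (max (-(c * u t).re) 0) ^ 2 + ((c * u t).im) ^ 2 ≤ 4 * δ' / (3 / 1000000000000 - 2 * δ') :=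
  groundState_8046_almost_nonneg_of_gapCertificate_tw2 gc_memLp_m80Pv0 hδ' hm gc_gapCertificate_8046 hu

/-- **Every ground state at `a = 4023/5000` is non-negative up to `0.4 %` in `L²`**: for some unit `c`,
`∫ ((Re(c u))⁻)² + (Im(c u))² ≤ 1/68000` (`δ' = 1.1·10⁻¹⁷` in `groundState_8046_almost_nonneg`;
`√(1/68000) < 3.9·10⁻³`). [folklore] -/
theorem groundState_8046_negPart_le {u : ℝ → ℂ} (hu : IsWeilGroundState (4023 / 5000 : ℝ) u) :
    ∃ c : ℂ, ‖c‖ = 1 ∧ ∫ t, (max (-(c * u t).re) 0) ^ 2 + ((c * u t).im) ^ 2 ≤ 1 / 68000 := by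
  obtain ⟨c, hc, h⟩ := groundState_8046_almost_nonneg (δ' := 11 / 1000000000000000000) (by norm_num) (by norm_num) hu
  exact ⟨c, hc, h.trans (by norm_num)⟩

/-! ## Band versions: every window `a ≤ 4023/5000` whose cone bottom is certified -/

/-- **Generic band form.**  At a window `0 < a ≤ 4023/5000` with cone bottom `ε₊(a) ≤ δ₀`, for every `δ' > δ₀` with
`2δ' < 3·10⁻¹²` and every ground state `u` of the full windowed Weil form at `a`, some unit `c` has
`∫ ((Re(c u))⁻)² + (Im(c u))² ≤ 4δ'/(3·10⁻¹² − 2δ')`.  The gap certificate `gc_gapCertificate_8046` of the window `4023/5000`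
RESTRICTS to the window `a` (an even test on `[−a, a]` is one on `[−4023/5000, 4023/5000]`, and `Q` does not see the window);
positivity `weilPositivityOn_of_le_8046`; parity `groundStates_ae_even_of_le_log5half`. [folklore] -/
theorem groundState_almost_nonneg_of_le_8046 {a δ₀ δ' : ℝ} (ha : 0 < a) (ha' : a ≤ 4023 / 5000)
    (hcone : sInf (weilWindowSphereValues (fun g : ℝ → ℂ ↦ ∀ t, (g t).im = 0 ∧ 0 ≤ (g t).re) a) ≤ δ₀)
    (hδ' : δ₀ < δ') (hm : 2 * δ' < (3 / 1000000000000 : ℝ)) {u : ℝ → ℂ} (hu : IsWeilGroundState a u) :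
    ∃ c : ℂ, ‖c‖ = 1 ∧
      ∫ t, (max (-(c * u t).re) 0) ^ 2 + ((c * u t).im) ^ 2 ≤ 4 * δ' / (3 / 1000000000000 - 2 * δ') := by
  have h5 : a ≤ Real.log 5 / 2 := ha'.trans m80_le_log5half
  have hae := groundStates_ae_even_of_le_log5half a ha h5 u hu
  obtain ⟨hsym, hue⟩ := isWeilEvenGroundState_symm_of_ae_even_tw2 hu hae
  have hI : Icc (-a) a ⊆ Icc (-(4023 / 5000 : ℝ)) (4023 / 5000) := Icc_subset_Icc (neg_le_neg ha') ha'
  obtain ⟨c, hc, hint⟩ := even_groundState_almost_nonneg_of_coneBottom_lt_tw2 ha (weilPositivityOn_of_le_8046 ha')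
    (hcone.trans_lt hδ') hue gc_memLp_m80Pv0 hm
    (fun k hk hs he ho ↦ gc_gapCertificate_8046 k hk (hs.trans hI) he ho)
  exact ⟨c, hc, (integral_negPart_sq_add_im_sq_congr_ae_tw2 hsym c) ▸ hint⟩

/-- ★ **BAND `[39/50, 4023/5000]`: EVERY GROUND STATE OF THE WINDOWED WEIL FORM AT EVERY `a ∈ [39/50, 4023/5000]` IS
NON-NEGATIVE UP TO `1/4400` IN `L²` (unconditional, RH-free, uniform on the band).**  Cone bottom `ε₊(a) ≤ ε₊(39/50) ≤ 1/(6·10¹⁵)`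
(`coneBottom_78_le`, `coneBottom_anti`), `δ' = 1.7·10⁻¹⁶`. [folklore] -/
theorem groundState_band78_negPart_le {a : ℝ} (ha : (39 / 50 : ℝ) ≤ a) (ha' : a ≤ 4023 / 5000) {u : ℝ → ℂ}
    (hu : IsWeilGroundState a u) :
    ∃ c : ℂ, ‖c‖ = 1 ∧ ∫ t, (max (-(c * u t).re) 0) ^ 2 + ((c * u t).im) ^ 2 ≤ 1 / 4400 := by
  have ha0 : 0 < a := lt_of_lt_of_le (by norm_num) ha
  obtain ⟨c, hc, h⟩ := groundState_almost_nonneg_of_le_8046 (δ' := 17 / 100000000000000000) ha0 ha'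
    ((coneBottom_anti (by norm_num) ha).trans coneBottom_78_le) (by norm_num) (by norm_num) hu
  exact ⟨c, hc, h.trans (by norm_num)⟩

/-- **Band `[77/100, 4023/5000]`: every ground state at every `a` there is non-negative up to `1/22` in `L²`** (cone bottom
`ε₊(77/100) ≤ 1/(32·10¹²)`, `δ' = 3.2·10⁻¹⁴`). [folklore] -/
theorem groundState_band77_negPart_le {a : ℝ} (ha : (77 / 100 : ℝ) ≤ a) (ha' : a ≤ 4023 / 5000) {u : ℝ → ℂ}
    (hu : IsWeilGroundState a u) :
    ∃ c : ℂ, ‖c‖ = 1 ∧ ∫ t, (max (-(c * u t).re) 0) ^ 2 + ((c * u t).im) ^ 2 ≤ 1 / 22 := by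
  have ha0 : 0 < a := lt_of_lt_of_le (by norm_num) ha
  obtain ⟨c, hc, h⟩ := groundState_almost_nonneg_of_le_8046 (δ' := 32 / 1000000000000000) ha0 ha'
    ((coneBottom_anti (by norm_num) ha).trans coneBottom_77_le) (by norm_num) (by norm_num) hu
  exact ⟨c, hc, h.trans (by norm_num)⟩

/-- **Band `[3/4, 4023/5000]`: every ground state at every `a` there is non-negative up to `1/9` in `L²`** (cone bottom
`ε₊(3/4) ≤ 1/(14·10¹²)`, `δ' = 7.2·10⁻¹⁴`). [folklore] -/
theorem groundState_band75_negPart_le {a : ℝ} (ha : (3 / 4 : ℝ) ≤ a) (ha' : a ≤ 4023 / 5000) {u : ℝ → ℂ}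
    (hu : IsWeilGroundState a u) :
    ∃ c : ℂ, ‖c‖ = 1 ∧ ∫ t, (max (-(c * u t).re) 0) ^ 2 + ((c * u t).im) ^ 2 ≤ 1 / 9 := by
  have ha0 : 0 < a := lt_of_lt_of_le (by norm_num) ha
  obtain ⟨c, hc, h⟩ := groundState_almost_nonneg_of_le_8046 (δ' := 72 / 1000000000000000) ha0 ha'
    ((coneBottom_anti (by norm_num) ha).trans coneBottom_75_le) (by norm_num) (by norm_num) hu
  exact ⟨c, hc, h.trans (by norm_num)⟩

end Summit.RiemannHypothesis.RiemannHypothesis.Theorems.PolarPerronFrobenius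

end
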